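import Literature.MathematicalPhysics.QuantumFieldTheory.QCDGammaFiveConjugation
import Summits.QuantumFields.QCD.Theorems.QuarksNoInfraredClauseTorusHalfSpectrumStubGammaFiveConjExists
import HarnessLib

/-!
# Crux `TorusHalfSpectrum` (stmt-QuantumFields-9508), line `registered` — stub K1
# `stub_gammaFiveConj_expect`, auxiliary file: the `γ₅`-conjugation on exponentials and quadratic actions

Auxiliary (public) lemmas for the stubs K1 (`stub_gammaFiveConj_expect`, periodic functional) and K1'
(`stub_gammaFiveConj_expectAP`, antiperiodic functional) of the birth skeleton of the crux
`Summit.QuantumFields.QCD.Theses.QuarksNoInfraredClause.TorusHalfSpectrum`, about the Literature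
`γ₅`-conjugation `torusK = Λ(K₀) ∘ conj` of the torus quark Grassmann algebra
(`QCDGammaFiveConjugation.lean`):

* `torusK_grassmannExp` — `K (exp x) = exp (K x)` for nilpotent `x` (`K` is a ring endomorphism,
  `IsNilpotent.map_exp`);
* `torusK_psi`, `torusK_psiBar`, `torusK_psiBar_mul_psi` — the generator values in the `psi`/`psiBar`
  spelling and `K (ψ̄_v ψ_w) = ∑_{δε} (γ₅)_{σ_v ε} (γ₅)_{δ σ_w} ψ̄_{w_δ} ψ_{v_ε}` (one anticommutation
  `ψψ̄ = −ψ̄ψ` absorbs the sign of `K₀`);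
* `torusK_quadratic` — **`K (ψ̄ A ψ) = ψ̄ A^K ψ`** with `A^K = kMatrix A`
  (`(A^K)_{pq} = ∑_{αβ} (γ₅)_{σ_p β} conj A_{q_α p_β} (γ₅)_{α σ_q}`), the `γ₅` analogue of
  `torusTheta_quadratic` WITHOUT order reversal and site reflection (reindexing involution
  `(v, w, δ, ε) ↦ (w_δ, v_ε, σ_v, σ_w)` of the fourfold sum);
* `integral_fermiIntegral_torusK` — `∫dμ ∫dψ̄dψ (K F) = det K₀ · conj ∫dμ ∫dψ̄dψ F` for any outer measure
  (`fermiIntegral_torusK`, `integral_conj`);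
* `div_eq_conj_div_of_eq_mul_conj` — the ratio bookkeeping `N' = c·conj N`, `D = c·conj D` ⇒
  `N'/D = conj (N/D)` (junk branch `D = 0` included; `D ≠ 0` forces `c ≠ 0`).

Everything used is proved in the tree.  Sources: I. Montvay, G. Münster, *Quantum Fields on a Lattice*
(CUP 1994) §4.2 (4.35) (`γ₅`-hermiticity), §5.1.2 (5.15)–(5.16); the packaging as an antilinear Grassmann
ring map is folklore.
-/

noncomputable section

namespace Summit.QuantumFields.QCD.Cruxes.TorusHalfSpectrum.Birth.GammaFiveConjExpect

open scoped BigOperators ComplexConjugate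
open MeasureTheory
open Literature.Probability.LatticeModels Literature.MathematicalPhysics.QuantumFieldTheory
  Literature.MathematicalPhysics.QuantumLattice
open Summit.QuantumFields.QCD.Cruxes.TorusHalfSpectrum.Birth.GammaFiveConjExists

variable {Nf L : ℕ} [NeZero L]

/-! ### `K` of an exponential -/

/-- **`K` of an exponential is the exponential of `K`** (nilpotent arguments; `K` is a ring
endomorphism, `IsNilpotent.map_exp`). [folklore] -/
theorem torusK_grassmannExp {x : FermiAlg Nf L} (hx : IsNilpotent x) :
    torusK (grassmannExp x) = grassmannExp (torusK x) := by
  change torusKRingHom (IsNilpotent.exp x) = IsNilpotent.exp (torusKRingHom x)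
  exact IsNilpotent.map_exp hx _

/-! ### `K` on generators and on pairs -/

/-- `K ψ_v = −∑_β (γ₅)_{β σ_v} ψ̄_{v_β}` in the `psi`/`psiBar` spelling. [folklore] -/
theorem torusK_psi (v : QuarkVar Nf L) :
    torusK (psi ℂ (quarkEquiv v)) =
      -∑ β : Fin 4, gammaFive β v.2.2.2 • psiBar ℂ (quarkEquiv (v.1, (v.2.1, v.2.2.1, β))) :=
  torusK_q' v

/-- `K ψ̄_v = ∑_β (γ₅)_{σ_v β} ψ_{v_β}` in the `psi`/`psiBar` spelling. [folklore] -/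
theorem torusK_psiBar (v : QuarkVar Nf L) :
    torusK (psiBar ℂ (quarkEquiv v)) =
      ∑ β : Fin 4, gammaFive v.2.2.2 β • psi ℂ (quarkEquiv (v.1, (v.2.1, v.2.2.1, β))) :=
  torusK_qbar' v

/-- **`K` on a pair**: `K (ψ̄_v ψ_w) = ∑_δ ∑_ε (γ₅)_{σ_v ε} (γ₅)_{δ σ_w} ψ̄_{w_δ} ψ_{v_ε}` — `K` preserves
the order, and the one anticommutation `ψ_{v_ε} ψ̄_{w_δ} = −ψ̄_{w_δ} ψ_{v_ε}` absorbs the sign of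
`K ψ = −ψ̄γ₅`. [folklore] -/
theorem torusK_psiBar_mul_psi (v w : QuarkVar Nf L) :
    torusK (psiBar ℂ (quarkEquiv v) * psi ℂ (quarkEquiv w)) =
      ∑ δ : Fin 4, ∑ ε : Fin 4, (gammaFive v.2.2.2 ε * gammaFive δ w.2.2.2) •
        (psiBar ℂ (quarkEquiv (w.1, (w.2.1, w.2.2.1, δ))) *
          psi ℂ (quarkEquiv (v.1, (v.2.1, v.2.2.1, ε)))) := by
  rw [torusK_mul, torusK_psiBar, torusK_psi, mul_neg, Finset.mul_sum, ← Finset.sum_neg_distrib]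
  refine Finset.sum_congr rfl fun δ _ => ?_
  rw [Finset.sum_mul, ← Finset.sum_neg_distrib]
  refine Finset.sum_congr rfl fun ε _ => ?_
  rw [smul_mul_smul_comm, psi_mul_psiBar, smul_neg, neg_neg]

/-! ### `K` on quadratic actions -/

/-- **`K (ψ̄ A ψ) = ψ̄ A^K ψ`**: the `γ₅`-conjugate of a quadratic action is the quadratic action of
`kMatrix A` (both sides are the fourfold sum `∑_{v,w,δ,ε}`, matched by the reindexing involution
`(v, w, δ, ε) ↦ (w_δ, v_ε, σ_v, σ_w)`). [cite: MontvayMunster1994, §4.2 (4.35)] -/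
theorem torusK_quadratic (A : Matrix (FermiIdx Nf L) (FermiIdx Nf L) ℂ) :
    torusK (quadratic ℂ A) = quadratic ℂ (kMatrix A) := by
  -- both sides as a single sum over `(v, w, δ, ε)`
  set F : QuarkVar Nf L × QuarkVar Nf L × Fin 4 × Fin 4 → FermiAlg Nf L := fun t =>
    (star (A (quarkEquiv t.1) (quarkEquiv t.2.1)) *
        (gammaFive t.1.2.2.2 t.2.2.2 * gammaFive t.2.2.1 t.2.1.2.2.2)) •
      (psiBar ℂ (quarkEquiv (t.2.1.1, (t.2.1.2.1, t.2.1.2.2.1, t.2.2.1))) *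
        psi ℂ (quarkEquiv (t.1.1, (t.1.2.1, t.1.2.2.1, t.2.2.2)))) with hF
  set G : QuarkVar Nf L × QuarkVar Nf L × Fin 4 × Fin 4 → FermiAlg Nf L := fun t =>
    (gammaFive t.1.2.2.2 t.2.2.2 *
        star (A (kSpinIdx (quarkEquiv t.2.1) t.2.2.1) (kSpinIdx (quarkEquiv t.1) t.2.2.2)) *
          gammaFive t.2.2.1 t.2.1.2.2.2) •
      (psiBar ℂ (quarkEquiv t.1) * psi ℂ (quarkEquiv t.2.1)) with hG
  have hL : torusK (quadratic ℂ A) = ∑ t, F t := by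
    rw [quadratic, map_sum, ← (quarkEquiv (Nf := Nf) (L := L)).sum_comp]
    conv_rhs => rw [Fintype.sum_prod_type]
    refine Finset.sum_congr rfl fun v _ => ?_
    rw [map_sum, ← (quarkEquiv (Nf := Nf) (L := L)).sum_comp]
    conv_rhs => rw [Fintype.sum_prod_type]
    refine Finset.sum_congr rfl fun w _ => ?_
    rw [LinearMap.map_smulₛₗ, torusK_psiBar_mul_psi, Finset.smul_sum]
    conv_rhs => rw [Fintype.sum_prod_type]
    refine Finset.sum_congr rfl fun δ _ => ?_
    rw [Finset.smul_sum]
    refine Finset.sum_congr rfl fun ε _ => ?_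
    rw [hF, smul_smul, starRingEnd_apply]
  have hR : quadratic ℂ (kMatrix A) = ∑ t, G t := by
    rw [quadratic, ← (quarkEquiv (Nf := Nf) (L := L)).sum_comp]
    conv_rhs => rw [Fintype.sum_prod_type]
    refine Finset.sum_congr rfl fun v _ => ?_
    rw [← (quarkEquiv (Nf := Nf) (L := L)).sum_comp]
    conv_rhs => rw [Fintype.sum_prod_type]
    refine Finset.sum_congr rfl fun w _ => ?_
    rw [kMatrix, Finset.sum_smul]
    conv_rhs => rw [Fintype.sum_prod_type]
    refine Finset.sum_congr rfl fun α _ => ?_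
    rw [Finset.sum_smul]
    refine Finset.sum_congr rfl fun β _ => ?_
    rw [hG, Equiv.symm_apply_apply, Equiv.symm_apply_apply]
  rw [hL, hR]
  -- the reindexing involution `(v, w, δ, ε) ↦ (w_δ, v_ε, σ_v, σ_w)`
  have he : Function.Involutive fun t : QuarkVar Nf L × QuarkVar Nf L × Fin 4 × Fin 4 =>
      (((t.2.1.1, (t.2.1.2.1, t.2.1.2.2.1, t.2.2.1)) : QuarkVar Nf L),
        ((t.1.1, (t.1.2.1, t.1.2.2.1, t.2.2.2)) : QuarkVar Nf L), t.1.2.2.2, t.2.1.2.2.2) := by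
    rintro ⟨⟨fv, xv, av, σv⟩, ⟨fw, xw, aw, σw⟩, δ, ε⟩
    rfl
  refine Fintype.sum_equiv (Function.Involutive.toPerm _ he) F G fun t => ?_
  obtain ⟨⟨fv, xv, av, σv⟩, ⟨fw, xw, aw, σw⟩, δ, ε⟩ := t
  simp only [hF, hG, Function.Involutive.coe_toPerm, kSpinIdx_quarkEquiv]
  congr 1
  ring

/-! ### Berezin and ratio bookkeeping -/

/-- **`∫dμ ∫dψ̄dψ (K F) = det K₀ · conj (∫dμ ∫dψ̄dψ F)`** for every outer measure `μ` (the fermionic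
Jacobian `fermiIntegral_torusK` configuration by configuration, then `∫ conj = conj ∫`). [folklore] -/
theorem integral_fermiIntegral_torusK {Ω : Type*} [MeasurableSpace Ω] (μ : Measure Ω)
    (F : Ω → FermiAlg Nf L) :
    ∫ U, fermiIntegral (torusK (F U)) ∂μ =
      kBerezinConst Nf L * starRingEnd ℂ (∫ U, fermiIntegral (F U) ∂μ) := by
  rw [← integral_conj, ← integral_const_mul]
  exact integral_congr_ae (Filter.Eventually.of_forall fun U => fermiIntegral_torusK (F U))

/-- **Ratio bookkeeping**: if `N' = c · conj N` and `D = c · conj D` for one constant `c`, then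
`N' / D = conj (N / D)` (if `D = 0` both sides are the junk `0`; otherwise `c ≠ 0` and
`conj D = D / c`). [folklore] -/
theorem div_eq_conj_div_of_eq_mul_conj {N N' D c : ℂ} (hN : N' = c * starRingEnd ℂ N)
    (hD : D = c * starRingEnd ℂ D) : N' / D = starRingEnd ℂ (N / D) := by
  by_cases hD0 : D = 0
  · rw [hD0, div_zero, div_zero, map_zero]
  have hc : c ≠ 0 := by
    rintro rfl
    exact hD0 (by rw [hD, zero_mul])
  have hD' : starRingEnd ℂ D = D / c := by
    rw [eq_div_iff hc, mul_comm]
    exact hD.symm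
  rw [map_div₀, hN, hD', div_div_eq_mul_div, mul_comm]

end Summit.QuantumFields.QCD.Cruxes.TorusHalfSpectrum.Birth.GammaFiveConjExpect

end
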